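import Mathlib
import Summits.QuantumFields.YangMills.Theses.CoarseStiffnessTail
import Summits.QuantumFields.YangMills.Theorems.CoarseStiffnessTailCappedCoarseStiffnessLUnitPolyTailOfChi

/-!
# Route `CoarseStiffnessTail` (rev 2 «unit-poly-tail») — THE DECIDING CRUX `UnitPolyTailL` (stmt-QuantumFields-24027) BY NAME FROM THE
# χ-LANE, and the route's own `closes` fired modulo the χ-lane's single stub (lead's bookkeeping certificate, seat `ym-line-cst-p1` g24)

WHAT.  Two standing suppliers of the re-typed deciding crux S1_poly = `CoarseStiffnessTail.UnitPolyTailL` exist in the tree as kernel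
theorems whose conclusion is the BODY of `UnitPolyTailL` verbatim:
* rev 0's crux `CappedCoarseStiffnessL` (stmt-QuantumFields-25301) — landed AT THE ROUTE DECL as the glue item
  `CoarseStiffnessTailUnitPolyTailOfStiffness.unitPolyTailOfStiffness_proof` (stmt-QuantumFields-24030, closed);
* the owner's χ-lane of crux stmt-QuantumFields-19936 (line v5p10): the record-free interior socket `AlphaInputsT3AC.IntCoreRecRows L` at
  every odd `L > 1`, hence v5p10's single registered stub `AlphaInputsT3ACv4RecChi L` (∀ odd `L > 1`) — landed only at the BODY
  (`CoarseStiffnessTailUnitPolyTailOfChi.unitPolyTail_of_intCoreRecRows` / `unitPolyTail_of_laneRecordsV4Chi`, g22, written before the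
  route decl `UnitPolyTailL` existed).
§1 matches the second supplier against the route decl: `unitPolyTailL_of_intCoreRecRows`, `unitPolyTailL_of_laneRecordsV4Chi` conclude
`UnitPolyTailL` BY NAME (so the gate records stmt-QuantumFields-24027 as proved CONDITIONALLY on exactly the χ-lane's socket / stub, the
same hypothesis the LINE-20 organ `stub_topTailDegradedEv` is downstream of, `CoarseStiffnessTailUnitPolyTailLTopTailSuppliers` §3).
§2 fires THIS route's deciding theorem `CoarseStiffnessTail.closes` with its two residual cruxes (`MinimiserStabilityRegPr`
stmt-QuantumFields-19200, `FluctuationComparisonRegPrIntL` stmt-QuantumFields-20520 — the route's byte-identical restatements), the χ-stub,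
and the glue `HistoryTailOfUnitPolyTail` (stmt-QuantumFields-24029, closed; supplied inline by g22's `historyTailL_of_unitPolyTail`, so that
this file imports no other module of the route's cone): route `CoarseStiffnessTail` rev 2 closes modulo the SAME
three open hypotheses as the parent route `UnitScaleTilt` with line v5p10 — the consolidation picture in kernel form.

HONEST FRAMING.  Pure bookkeeping (definitional unfolding + composition of landed theorems); every hypothesis (`IntCoreRecRows`,
`AlphaInputsT3ACv4RecChi`, the two residual cruxes) is an OPEN statement and nothing of [Balaban1985UV3] or [Balaban1985Variational] is
proved.  `UnitPolyTailL` (24027), `CappedCoarseStiffnessL` (25301), `HistoryTailL` (19936) stay OPEN.  `YM3TorusSU2` is rung R3 of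
LADDER-YM, a RECORD rung (existence and uniqueness of Bałaban's ultraviolet limit on the 3-torus), NOT the Clay statement; the Yang–Mills
mass gap is not touched.

References: [Balaban1985UV3] T. Bałaban, Commun. Math. Phys. **102** (1985) 255–275 ((5) p.256, (47) p.267, (71) p.273);
[Balaban1985Variational] ibid. 277–309 (Thm 1 (8) p.279); [King1986] C. King, Commun. Math. Phys. **103** (1986) 323–349.
-/

set_option autoImplicit false

noncomputable section

namespace Summit.QuantumFields.YangMills.Theorems.CoarseStiffnessTailUnitPolyTailLSuppliers

open Summit.QuantumFields.YangMills.Theses.CoarseStiffnessTail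
open Summit.QuantumFields.YangMills.Theorems.CoarseStiffnessTailUnitPolyTailOfChi
  (unitPolyTail_of_intCoreRecRows unitPolyTail_of_laneRecordsV4Chi)
open Summit.QuantumFields.YangMills.Theorems.CoarseStiffnessTailUnitPolyTail (historyTailL_of_unitPolyTail)

/-! ## §1 The χ-lane's socket and stub deliver the crux by name -/

/-- ★ **THE χ-LANE's RECORD-FREE SOCKET ⇒ `UnitPolyTailL`**: `AlphaInputsT3AC.IntCoreRecRows L` for every odd `L > 1` (the interior
(47)′ row of a family of (41)-data cores, the shape the 19936 cone consumes) implies the route's deciding crux S1_poly BY NAME — by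
`unitPolyTail_of_intCoreRecRows` (top slice of the volume-free per-plaquette tail + absorption `e^{−c′p(√γ)²} ≤ γ⁴`; bare cut-off by the
clean torus count), whose conclusion is the body of `UnitPolyTailL` verbatim.  Conditional certificate; both sides OPEN; nothing of
[Balaban1985UV3] is proved. [cite: Balaban1985UV3, (5) p.256, (47) p.267 and (71) p.273] -/
theorem unitPolyTailL_of_intCoreRecRows (hrec : ∀ L : ℕ, Odd L → 1 < L → AlphaInputsT3AC.IntCoreRecRows L) :
    UnitPolyTailL := by
  unfold UnitPolyTailL
  exact unitPolyTail_of_intCoreRecRows hrec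

/-- ★ **v5p10's SINGLE STUB ⇒ `UnitPolyTailL`**: `AlphaInputsT3ACv4RecChi L` for every odd `L > 1` (the version-4 χ-record, the one
registered stub `stub_laneRecordsV4Chi` of crux stmt-QuantumFields-19936's line v5p10) implies the route's deciding crux BY NAME
(`unitPolyTail_of_laneRecordsV4Chi` = the socket instance `intCoreRecRows_of_laneRecordsV4Chi` + §1).  So stmt-QuantumFields-24027 is
closed MODULO that stub and nothing else.  Conditional certificate; both sides OPEN.
[cite: Balaban1985UV3, (5) p.256, (47) p.267 and (71) p.273; Balaban1985Variational, Thm 1 (8) p.279] -/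
theorem unitPolyTailL_of_laneRecordsV4Chi
    (hrec : ∀ L : ℕ, Odd L → 1 < L → Summit.QuantumFields.YangMills.Theorems.AlphaInputsT3ACv4RecChi L) :
    UnitPolyTailL := by
  unfold UnitPolyTailL
  exact unitPolyTail_of_laneRecordsV4Chi hrec

/-! ## §2 The route's deciding theorem fired modulo the χ-stub -/

/-- **ROUTE `CoarseStiffnessTail` rev 2 CLOSES MODULO {19200, 20520, the χ-socket}**: the route's own `closes` applied to its two residual
cruxes (`MinimiserStabilityRegPr` = stmt-QuantumFields-19200, `FluctuationComparisonRegPrIntL` = stmt-QuantumFields-20520, byte-identical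
restatements of the parent route's), to `UnitPolyTailL` supplied by the record-free socket (§1), and to the glue binder
`HistoryTailOfUnitPolyTail` (stmt-QuantumFields-24029, closed) inhabited inline by `historyTailL_of_unitPolyTail`.  CONDITIONAL on three
OPEN hypotheses; the leaf is rung R3, a RECORD rung, not the Clay statement. [cite: Balaban1985UV3, (5) p.256 and (71) p.273; King1986, (3.12) p.657] -/
theorem ym3TorusSU2_of_residuals_and_intCoreRecRows (h200 : MinimiserStabilityRegPr) (h201 : FluctuationComparisonRegPrIntL)
    (hrec : ∀ L : ℕ, Odd L → 1 < L → AlphaInputsT3AC.IntCoreRecRows L) :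
    Literature.MathematicalPhysics.QuantumFieldTheory.Balaban1983to89.T3YM3TorusStatement.YM3TorusSU2 :=
  closes h200 h201 (unitPolyTailL_of_intCoreRecRows hrec) fun hP => historyTailL_of_unitPolyTail hP

/-- **ROUTE `CoarseStiffnessTail` rev 2 CLOSES MODULO {19200, 20520, v5p10's stub}** — the same three open hypotheses as the parent route
`UnitScaleTilt` with line v5p10: the route's `closes` on the residual cruxes, `unitPolyTailL_of_laneRecordsV4Chi` and the glue inline.
CONDITIONAL; a RECORD rung, not Clay; recorded as the kernel form of the consolidation «CoarseStiffnessTail rev 2 needs nothing beyond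
the χ-lane's single stub». [cite: Balaban1985UV3, (5) p.256 and (71) p.273; Balaban1985Variational, Thm 1 (8) p.279; King1986, (3.12) p.657] -/
theorem ym3TorusSU2_of_residuals_and_laneRecordsV4Chi (h200 : MinimiserStabilityRegPr) (h201 : FluctuationComparisonRegPrIntL)
    (hrec : ∀ L : ℕ, Odd L → 1 < L → Summit.QuantumFields.YangMills.Theorems.AlphaInputsT3ACv4RecChi L) :
    Literature.MathematicalPhysics.QuantumFieldTheory.Balaban1983to89.T3YM3TorusStatement.YM3TorusSU2 :=
  closes h200 h201 (unitPolyTailL_of_laneRecordsV4Chi hrec) fun hP => historyTailL_of_unitPolyTail hP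

end Summit.QuantumFields.YangMills.Theorems.CoarseStiffnessTailUnitPolyTailLSuppliers

end
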